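/-
Origin: expansion seat `planner-pub-hodgecm-pv03-g7-0`, handover #3 2026-08-18T13:08:29Z (`HOME/pub-hodgecm-pv03-g7/lean/Pv03g7/GenericFactsAll3.lean`, md5 d73b55d4, 66 lines);
landed by the gen-8 packager in gate run 30 as `HodgeCM/Model/ToyG2/GenericFactsAll3.lean` (import ^import Pv03g7\.Gysin3[ \t]*$→import HodgeCM.Model.ToyG2.Gysin3 ×1).
-/
/-
pub-hodgecm cell (HodgeCMPerL) — DAG-node prover #03, generation 7 (`planner-pub-hodgecm-pv03-g7-0`, unit `pub-hodgecm-pv03-g7`).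
WIP module `Pv03g7.GenericFactsAll3`; intended tree module `HodgeCM.Model.ToyG2.GenericFactsAll3` (kind L5: toy model /
consistency witness; ONE NEW ADDITIVE LEAF).  WIP import `Pv03g7.Gysin3` ↦ `HodgeCM.Model.ToyG2.Gysin3` (this seat);
`HodgeCM.Model.ToyG2.TrTopAll3` is toy-g3's (gate run 29), imported by its final name.  Nothing is cited; kernel-proved from
the tree; Lean + Mathlib axioms only.

# All eleven binders of `Assembly.COR_CM_of_genericFacts` hold in ONE universe

toy-g3's `toyUniverse₃_genericFacts_but_gysin_all` (`TrTopAll3`, on pv03-g6's `toyUniverse₃_modelAxioms_all`) gives ten of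
the eleven binders of `HodgeCM.Assembly.COR_CM_of_genericFacts` in `toyUniverse₃ d t` (`1 ≤ d`, `t² = 16`); this seat's
`toyUniverse₃_fact_gysin` (`Gysin3`) is the eleventh, F7 `Fact_gysin`.  Hence:

* `toyUniverse₃_genericFacts_all` — ModelAxioms ∧ RealisationExistsFace ∧ N1 ∧ N2 ∧ N3 ∧ N4 ∧ F4 ∧ F5 ∧ F7 ∧ Fact_dimProd ∧
  T-CM, jointly, in `toyUniverse₃ d t`;
* `exists_genericFacts_inputs` — the hypothesis set of `COR_CM_of_genericFacts` is JOINTLY SATISFIABLE (witness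
  `toyUniverse₃ 1 4`, a universe with nonzero traces: `toyUniverse₃_tr_pms_ne_zero`), so that kernel theorem is not
  vacuously hypothesised;
* `toyUniverse₃_HC_CM` — its conclusion COR-CM `HC_CM`, obtained in `toyUniverse₃ d t` BY APPLYING the assembled theorem.

Nothing is said about complex projective varieties.  Default heartbeats.
-/
import Mathlib
import Summits.HodgeConjecture.HodgeCM.Model.ToyG2.Gysin3_2
import Summits.HodgeConjecture.HodgeCM.Model.ToyG2.TrTopAll3
import Summits.HodgeConjecture.HodgeCM.StubTree.Qw8Monomial_3

/-! PORT of `HodgeCM/Model/ToyG2/GenericFactsAll3.lean` (HodgeCMPerL run 82) — verbatim mechanical port; provenance in the PORT header line. -/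

noncomputable section

namespace HodgeCM.ToyG2

open HodgeCM.Toy

variable (d t : ℚ)

/-- **All eleven binders of `Assembly.COR_CM_of_genericFacts`, jointly, in `toyUniverse₃ d t`** (`1 ≤ d`, `t² = 16`):
`ModelAxioms ∧ RealisationExistsFace ∧ N1 ∧ N2 ∧ N3 ∧ N4 ∧ F4 ∧ F5 ∧ F7 ∧ Fact_dimProd ∧ Fact_trTopCM`. -/
theorem toyUniverse₃_genericFacts_all (hd : 1 ≤ d) (ht : t ^ 2 = 16) :
    (toyUniverse₃ d t).ModelAxioms ∧ (toyUniverse₃ d t).RealisationExistsFace ∧ (toyUniverse₃ d t).Fact_cupExterior ∧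
      (toyUniverse₃ d t).Fact_cup_hodge ∧ (toyUniverse₃ d t).Fact_pull_H0 ∧ (toyUniverse₃ d t).Fact_hodge_F0 ∧
      (toyUniverse₃ d t).Fact_cupAlg ∧ (toyUniverse₃ d t).Fact_cupAssoc ∧ (toyUniverse₃ d t).Fact_gysin ∧
      (toyUniverse₃ d t).Fact_dimProd ∧ (toyUniverse₃ d t).Fact_trTopCM := by
  obtain ⟨M, hR, h1, h2, h3, h4, h5, h6, hdp, htc⟩ := toyUniverse₃_genericFacts_but_gysin_all d t hd ht
  exact ⟨M, hR, h1, h2, h3, h4, h5, h6, toyUniverse₃_fact_gysin d t, hdp, htc⟩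

/-- **Existence: the eleven binders of `Assembly.COR_CM_of_genericFacts` are jointly satisfiable** (witness `toyUniverse₃ 1 4`). -/
theorem exists_genericFacts_inputs :
    ∃ U : Universe, U.ModelAxioms ∧ U.RealisationExistsFace ∧ U.Fact_cupExterior ∧ U.Fact_cup_hodge ∧ U.Fact_pull_H0 ∧
      U.Fact_hodge_F0 ∧ U.Fact_cupAlg ∧ U.Fact_cupAssoc ∧ U.Fact_gysin ∧ U.Fact_dimProd ∧ U.Fact_trTopCM :=
  ⟨toyUniverse₃ 1 4, toyUniverse₃_genericFacts_all 1 4 le_rfl (by norm_num)⟩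

/-- **COR-CM in `toyUniverse₃ d t` by the assembled theorem**: `Assembly.COR_CM_of_genericFacts` APPLIED to the eleven
witnesses (`1 ≤ d`, `t² = 16`). -/
theorem toyUniverse₃_HC_CM (hd : 1 ≤ d) (ht : t ^ 2 = 16) : (toyUniverse₃ d t).HC_CM := by
  obtain ⟨M, hR, h1, h2, h3, h4, h5, h6, h7, hdp, htc⟩ := toyUniverse₃_genericFacts_all d t hd ht
  exact Assembly.COR_CM_of_genericFacts _ M hR h1 h2 h3 h4 h5 h6 h7 hdp htc

/-- some universe satisfies all eleven binders of `Assembly.COR_CM_of_genericFacts` AND (therefore) its conclusion COR-CM -/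
theorem exists_genericFacts_inputs_and_HC_CM :
    ∃ U : Universe, (U.ModelAxioms ∧ U.RealisationExistsFace ∧ U.Fact_cupExterior ∧ U.Fact_cup_hodge ∧ U.Fact_pull_H0 ∧
      U.Fact_hodge_F0 ∧ U.Fact_cupAlg ∧ U.Fact_cupAssoc ∧ U.Fact_gysin ∧ U.Fact_dimProd ∧ U.Fact_trTopCM) ∧ U.HC_CM :=
  ⟨toyUniverse₃ 1 4, toyUniverse₃_genericFacts_all 1 4 le_rfl (by norm_num), toyUniverse₃_HC_CM 1 4 le_rfl (by norm_num)⟩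

end HodgeCM.ToyG2

end
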